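import Literature.AlgebraicGeometry.AbelianSchemes.PELTupleSpreadStage   -- ★ (mine) GSPREAD-CORE head `exists_stage_pelTuple_of_generic`; re-exports the MOVE file, GS-2-core, `TupleRelCancel`, `tupleRel_refl`
import HarnessLib

/-!
# GSPREAD-CORE for a generic base IDENTIFIED with `P ⊗_A K`, and its localisation at the points of a stage

The E-witness of the moduli problem lives over the generic fibre `X` of an integral model `𝓜` (`𝓜.genericIso : 𝓜.total ⊗ Spec K ≅ X`), not
literally over `𝓜.total ⊗ Spec K`.  §1: for any scheme `Z` with an isomorphism `e : Z ≅ P ⊗_A K` and an `𝒪`-PEL tuple over `Z`, the tuple is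
the base change along `e ≫ (P ⊗ Spec K → P ⊗ D(s))` of a PEL tuple over a stage — ★ `exists_stage_pelTuple_of_generic` for the base change of the
tuple along `e⁻¹`, composed (★ `tupleRel_trans`) with the six clauses «a tuple over `Z` is the base change along `e` of its base change along `e⁻¹`»
(★ `exists_tupleRel_of_comp` cancelling ★ `tupleRel_refl` re-read along `𝟙 = e ≫ e⁻¹` against ★ `tupleRel_baseChange_fst`; no connectedness of `Z`).
§2: the same stage tuple read at every `A`-algebra `T` through which the stage is reached (`τ : Spec T → D(s)`, `κ : Spec K → Spec T`): the `Z`-tuple is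
related to the `T`-tuple `(𝒜, ι, Â, 𝒫, λ, φ) ×_{P ⊗ D(s)} (P ⊗ Spec T)` along `e ≫ (P ◁ κ)` (★ GS-2-core `exists_tupleRel_stage_baseChange_of_tupleRel_comp_whiskerLeft`)
— for `A = 𝒪_F`, `T = 𝒪_{F,(w)}` this is the generic reading `gen_iso` of the spread at `w` with `e ≫ (P ◁ κ) = genIncl` (★ `genericIso'_inv_left_comp_fst`).

## What existed / was missing / was proved
* existed (★): `exists_stage_pelTuple_of_generic`, `tupleRel_refl`, `tupleRel_congr_base`, `tupleRel_baseChange_fst`, `exists_tupleRel_of_comp`,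
  `tupleRel_trans`, `whiskerLeft_left_comp_whiskerLeft_left_eq_leg`, `exists_tupleRel_stage_baseChange_of_tupleRel_comp_whiskerLeft`.
* missing, proved here (sorry-free): `exists_tupleRel_baseChange_inv_of_iso` (§1), `exists_stage_pelTuple_of_generic_of_iso_base` (§1),
  `exists_stage_pelTuple_of_generic_of_iso_base_localise` (§2); EDITION 2 (§3, appended): the POINTWISE reading `exists_tupleRel_id_baseChange_of_tupleRel`
  (a six-clause relation along `m₀` read at every `t : T′ → Z` as an isomorphism of the pulled-back tuples along `𝟙 T′`, ★ uniqueness of pull-backs —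
  no connectedness) and `exists_stage_pelTuple_of_generic_of_iso_base_pointwise` (the `TupleIsoVia`-shaped `gen_iso` clauses of the spread at every point).
-/

set_option autoImplicit false

noncomputable section

-- Mathlib's `Over`/pull-back API is stated across semireducible wrappers (as in the ★ `AbelianSchemes/*` files).
set_option backward.isDefEq.respectTransparency false

open CategoryTheory CategoryTheory.Limits AlgebraicGeometry MonoidalCategory
open Literature.AlgebraicGeometry.Limits Literature.AlgebraicGeometry.Limits.LocApprox
open Literature.AlgebraicGeometry.Motives (SchemeOver specOver)

namespace Literature.AlgebraicGeometry.AbelianSchemes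

namespace AbelianSchemeOver

/-! ### §1 A tuple over `Z ≅ Y` is the base change along `e` of its base change along `e⁻¹`; the head over an identified generic base -/

section IsoBase

universe u

variable {Z Y : Scheme.{u}} (e : Z ≅ Y) (𝒜 : AbelianSchemeOver Z) {O : Type*} [CommRing O] (ρ : RingAction O 𝒜) (D : 𝒜.DualPair)
  (pol : 𝒜.Polarization D) {g n : ℕ} (φ : 𝒜.LevelStructure g n)

/-- **A TUPLE OVER `Z` IS THE BASE CHANGE ALONG `e : Z ≅ Y` OF ITS BASE CHANGE ALONG `e⁻¹`** (six clauses along `e.hom`, with `𝒪`-action): ★ `tupleRel_refl`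
re-read along `𝟙 Z = e.hom ≫ e.inv` (★ `tupleRel_congr_base`) CANCELLED (★ `exists_tupleRel_of_comp`) against the canonical relation of the base change along
`e.inv` (★ `tupleRel_baseChange_fst`).  No connectedness or reducedness of `Z`. [cite: MumfordFogartyKirwan1994, Ch. 7 §2 Definition 7.2 (p. 129)]
[cite: GortzWedhorn2020, Prop. 4.16 (p. 101) and Section (4.7) (pp. 107–108)] -/
theorem exists_tupleRel_baseChange_inv_of_iso :
    ∃ (m : 𝒜.X.left ⟶ (𝒜.baseChange e.inv).X.left) (mh : D.hat.X.left ⟶ (D.baseChange e.inv).hat.X.left),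
      φ.IsBaseChangeVia (φ.baseChange e.inv) e.hom m ∧ D.hat.IsBaseChangeVia (D.baseChange e.inv).hat e.hom mh ∧
      (∃ (wG : 𝒜.X.hom ≫ e.hom = m ≫ (𝒜.baseChange e.inv).X.hom) (wĜ : D.hat.X.hom ≫ e.hom = mh ≫ (D.baseChange e.inv).hat.X.hom),
        Nonempty ((Scheme.Modules.pullback
          (pullback.map 𝒜.X.hom D.hat.X.hom (𝒜.baseChange e.inv).X.hom (D.baseChange e.inv).hat.X.hom m mh e.hom wG wĜ)).obj
            (D.baseChange e.inv).P ≅ D.P)) ∧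
      pol.lam.left ≫ mh = m ≫ (pol.baseChange e.inv).lam.left ∧
      ∀ a : O, (ρ.i a).left ≫ m = m ≫ (baseChangeHom (ρ.i a) e.inv).left := by
  have h₁ := tupleRel_congr_base (e.hom_inv_id).symm (tupleRel_refl 𝒜 D pol.lam φ (fun a => ρ.i a))
  have h₂ := tupleRel_baseChange_fst 𝒜 ρ D pol φ e.inv
  obtain ⟨m, mh, -, -, h⟩ := exists_tupleRel_of_comp h₁ h₂
  exact ⟨m, mh, h⟩

end IsoBase

section Head

variable {A : Type} [CommRing A] [IsDomain A] [IsNoetherianRing A] (K : Type) [Field K] [CharZero K] [Algebra A K] [IsFractionRing A K]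
  {P : SchemeOver A} [QuasiCompact P.hom] [QuasiSeparated P.hom] [LocallyOfFinitePresentation P.hom] [IsSeparated P.hom]
  [∀ s : Idx (nonZeroDivisors A), IsLocallyNoetherian (P ⊗ (baseDiagram (nonZeroDivisors A)).obj s).left]
  [IsLocallyNoetherian (P ⊗ specOver A K).left] [IsReduced (P ⊗ specOver A K).left]

/-- **GSPREAD-CORE OVER AN IDENTIFIED GENERIC BASE.**  As ★ `exists_stage_pelTuple_of_generic`, for an `𝒪`-PEL tuple over ANY scheme `Z` with an
isomorphism `e : Z ≅ P ⊗_A K` (e.g. the generic fibre `X` of an integral model, `e = 𝓜.genericIso⁻¹`): the tuple is related by the six clauses along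
`e.hom ≫ (P ⊗ Spec K → P ⊗ D(s))` to a PEL tuple over a stage `P ⊗ D(s)` of relative dimension `g` with flat stage.  Proof: §1 + ★ head for the base change
along `e⁻¹` + ★ `tupleRel_trans`. [cite: MumfordFogartyKirwan1994, Ch. 7 §2 Definition 7.2 (p. 129) and §3 Proposition 7.3 (pp. 133–134)]
[cite: EGAIV3, Thm. 8.8.2 and Thm. 8.10.5] [cite: Kottwitz1992, §5 (pp. 389–391)] -/
theorem exists_stage_pelTuple_of_generic_of_iso_base (hP : IsProper (pullback.snd P.hom (specOver A K).hom)) (hdual : dualAbelianSchemeExists)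
    {O : Type*} [CommRing O] {m : ℕ} (bs : Module.Basis (Fin m) ℤ O) {g N : ℕ} [NeZero N] (hN : IsUnit ((N : ℕ) : K))
    {Z : Scheme.{0}} (e : Z ≅ (P ⊗ specOver A K).left)
    (A₁ : AbelianSchemeOver Z) (ρ₁ : RingAction O A₁) (D₁ : A₁.DualPair) (pol₁ : A₁.Polarization D₁)
    (φ₁ : A₁.LevelStructure g N) (hg : A₁.IsOfRelDim g) :
    ∃ (s : Idx (nonZeroDivisors A)) (𝒜 : AbelianSchemeOver (P ⊗ (baseDiagram (nonZeroDivisors A)).obj s).left) (ρ : RingAction O 𝒜)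
      (D : 𝒜.DualPair) (pol : 𝒜.Polarization D) (φ : 𝒜.LevelStructure g N) (G : A₁.X.left ⟶ 𝒜.X.left) (Ĝ : D₁.hat.X.left ⟶ D.hat.X.left),
      𝒜.IsOfRelDim g ∧ Flat (pullback.snd P.hom ((baseDiagram (nonZeroDivisors A)).obj s).hom) ∧
      (φ₁.IsBaseChangeVia φ (e.hom ≫ (P ◁ (baseCone (nonZeroDivisors A) K).π.app s).left) G ∧
        D₁.hat.IsBaseChangeVia D.hat (e.hom ≫ (P ◁ (baseCone (nonZeroDivisors A) K).π.app s).left) Ĝ ∧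
        (∃ (wG : A₁.X.hom ≫ e.hom ≫ (P ◁ (baseCone (nonZeroDivisors A) K).π.app s).left = G ≫ 𝒜.X.hom)
            (wĜ : D₁.hat.X.hom ≫ e.hom ≫ (P ◁ (baseCone (nonZeroDivisors A) K).π.app s).left = Ĝ ≫ D.hat.X.hom),
          Nonempty ((Scheme.Modules.pullback
            (pullback.map A₁.X.hom D₁.hat.X.hom 𝒜.X.hom D.hat.X.hom G Ĝ (e.hom ≫ (P ◁ (baseCone (nonZeroDivisors A) K).π.app s).left)
              wG wĜ)).obj D.P ≅ D₁.P)) ∧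
        pol₁.lam.left ≫ Ĝ = G ≫ pol.lam.left ∧ ∀ a : O, (ρ₁.i a).left ≫ G = G ≫ (ρ.i a).left) := by
  obtain ⟨m₁, mh₁, he⟩ := exists_tupleRel_baseChange_inv_of_iso e A₁ ρ₁ D₁ pol₁ φ₁
  obtain ⟨s, 𝒜, ρ, D, pol, φ, G, Ĝ, hg', hfl, hR⟩ := exists_stage_pelTuple_of_generic K hP hdual bs hN (A₁.baseChange e.inv)
    (ρ₁.baseChange e.inv) (D₁.baseChange e.inv) (pol₁.baseChange e.inv) (φ₁.baseChange e.inv) (hg.baseChange _)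
  exact ⟨s, 𝒜, ρ, D, pol, φ, m₁ ≫ G, mh₁ ≫ Ĝ, hg', hfl, tupleRel_trans he hR⟩

/-! ### §2 … read at the points of the stage: the `Z`-tuple against the `T`-tuple, along `e ≫ (P ◁ κ)` -/

/-- **GSPREAD-CORE, LOCALISED.**  In the situation of `exists_stage_pelTuple_of_generic_of_iso_base`, ONE stage tuple `(s, 𝒜, ι, (Â, 𝒫), λ, φ)` serves
every `A`-algebra `T` through which the stage is reached: for all `A`-morphisms `τ : Spec T → D(s)` (they exist iff `s ∈ T^×`, ★
`nonempty_hom_specOver_baseDiagram_of_isUnit`; for `A = 𝒪_F` and `T = 𝒪_{F,(w)}` for almost all `w`, ★ `eventually_nonempty_hom_specOver_valuationSubringAtPrime_baseDiagram`)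
and `κ : Spec K → Spec T`, the `Z`-tuple is related by the six clauses along `e.hom ≫ (P ◁ κ)` to the `T`-TUPLE `(𝒜, ι, Â, 𝒫, λ, φ) ×_{P ⊗ D(s)} (P ⊗ Spec T)`
(★ GS-2-core `exists_tupleRel_stage_baseChange_of_tupleRel_comp_whiskerLeft`, the base map re-read by ★ `whiskerLeft_left_comp_whiskerLeft_left_eq_leg`).  This is
the `gen_iso` provenance of the spread at `w` together with «the `T`-tuple IS the stage tuple base-changed along `P ◁ τ`».
[cite: EGAIV3, Thm. 8.8.2 and (8.8.2.5)] [cite: MumfordFogartyKirwan1994, Ch. 7 §2 Definition 7.2 (p. 129)] [cite: GortzWedhorn2020, Section (4.7) and Cor. 10.64 (pp. 107–108, 264–267)] -/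
theorem exists_stage_pelTuple_of_generic_of_iso_base_localise (hP : IsProper (pullback.snd P.hom (specOver A K).hom))
    (hdual : dualAbelianSchemeExists) {O : Type*} [CommRing O] {m : ℕ} (bs : Module.Basis (Fin m) ℤ O) {g N : ℕ} [NeZero N]
    (hN : IsUnit ((N : ℕ) : K)) {Z : Scheme.{0}} (e : Z ≅ (P ⊗ specOver A K).left)
    (A₁ : AbelianSchemeOver Z) (ρ₁ : RingAction O A₁) (D₁ : A₁.DualPair) (pol₁ : A₁.Polarization D₁)
    (φ₁ : A₁.LevelStructure g N) (hg : A₁.IsOfRelDim g) :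
    ∃ (s : Idx (nonZeroDivisors A)) (𝒜 : AbelianSchemeOver (P ⊗ (baseDiagram (nonZeroDivisors A)).obj s).left) (ρ : RingAction O 𝒜)
      (D : 𝒜.DualPair) (pol : 𝒜.Polarization D) (φ : 𝒜.LevelStructure g N),
      𝒜.IsOfRelDim g ∧ Flat (pullback.snd P.hom ((baseDiagram (nonZeroDivisors A)).obj s).hom) ∧
      ∀ {T : Type} [CommRing T] [Algebra A T] (τ : specOver A T ⟶ (baseDiagram (nonZeroDivisors A)).obj s)
        (κ : specOver A K ⟶ specOver A T),
        ∃ (G : A₁.X.left ⟶ (𝒜.baseChange (P ◁ τ).left).X.left) (Ĝ : D₁.hat.X.left ⟶ (D.baseChange (P ◁ τ).left).hat.X.left),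
          φ₁.IsBaseChangeVia (φ.baseChange (P ◁ τ).left) (e.hom ≫ (P ◁ κ).left) G ∧
          D₁.hat.IsBaseChangeVia (D.baseChange (P ◁ τ).left).hat (e.hom ≫ (P ◁ κ).left) Ĝ ∧
          (∃ (wG : A₁.X.hom ≫ e.hom ≫ (P ◁ κ).left = G ≫ (𝒜.baseChange (P ◁ τ).left).X.hom)
              (wĜ : D₁.hat.X.hom ≫ e.hom ≫ (P ◁ κ).left = Ĝ ≫ (D.baseChange (P ◁ τ).left).hat.X.hom),
            Nonempty ((Scheme.Modules.pullback
              (pullback.map A₁.X.hom D₁.hat.X.hom (𝒜.baseChange (P ◁ τ).left).X.hom (D.baseChange (P ◁ τ).left).hat.X.hom G Ĝ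
                (e.hom ≫ (P ◁ κ).left) wG wĜ)).obj (D.baseChange (P ◁ τ).left).P ≅ D₁.P)) ∧
          pol₁.lam.left ≫ Ĝ = G ≫ (pol.baseChange (P ◁ τ).left).lam.left ∧
          ∀ a : O, (ρ₁.i a).left ≫ G = G ≫ (baseChangeHom (ρ.i a) (P ◁ τ).left).left := by
  obtain ⟨s, 𝒜, ρ, D, pol, φ, G, Ĝ, hg', hfl, hR⟩ :=
    exists_stage_pelTuple_of_generic_of_iso_base K hP hdual bs hN e A₁ ρ₁ D₁ pol₁ φ₁ hg
  refine ⟨s, 𝒜, ρ, D, pol, φ, hg', hfl, fun {T} _ _ τ κ => ?_⟩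
  have hbase : e.hom ≫ (P ◁ (baseCone (nonZeroDivisors A) K).π.app s).left = (e.hom ≫ (P ◁ κ).left) ≫ (P ◁ τ).left := by
    rw [Category.assoc, whiskerLeft_left_comp_whiskerLeft_left_eq_leg (nonZeroDivisors A) K P s T τ κ]
  obtain ⟨G', Ĝ', -, -, h⟩ := exists_tupleRel_stage_baseChange_of_tupleRel_comp_whiskerLeft (nonZeroDivisors A) P s T 𝒜 ρ D pol φ τ
    (e.hom ≫ (P ◁ κ).left) (tupleRel_congr_base hbase hR)
  exact ⟨G', Ĝ', h⟩

/-! ### §3 (EDITION 2) The pointwise reading: at every `t : T′ → Z` the pulled-back tuples are isomorphic (the `gen_iso` clauses) -/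

/-- **A SIX-CLAUSE RELATION ALONG `m₀` READ AT A POINT.**  If `(G, Ĝ)` relates `(A₁, ι₁, (Â₁, 𝒫₁), λ₁, φ₁)` over `Z` to `(𝒜, ι, (Â, 𝒫), λ, φ)` over `W` along
`m₀ : Z → W`, then for every `t : T′ → Z` the pulled-back tuples `((𝒜, …) ×_W Z) ×_Z T′` and `(A₁, …) ×_Z T′` are ISOMORPHIC AS TUPLES (six clauses along
`𝟙 T′`, from the former to the latter): both are pull-backs of `(𝒜, …)` along `t ≫ m₀` (★ `tupleRel_baseChange_fst`, ★ `tupleRel_trans`), and pull-backs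
of tuples are unique up to an isomorphism of tuples (★ `exists_tupleRel_id_of_tupleRel_of_tupleRel`).  No connectedness or reducedness of `T′`.
[cite: MumfordFogartyKirwan1994, Ch. 7 §2 Definition 7.2 (p. 129) and Definition 7.3 (p. 130)] [cite: GortzWedhorn2020, Prop. 4.16 (p. 101) and Section (4.7) (pp. 107–108)] -/
theorem exists_tupleRel_id_baseChange_of_tupleRel {Z W : Scheme.{0}} {A₁ : AbelianSchemeOver Z} {O : Type*} [CommRing O]
    (ρ₁ : RingAction O A₁) (D₁ : A₁.DualPair) (pol₁ : A₁.Polarization D₁) {g n : ℕ} (φ₁ : A₁.LevelStructure g n)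
    (𝒜 : AbelianSchemeOver W) (ρ : RingAction O 𝒜) (D : 𝒜.DualPair) (pol : 𝒜.Polarization D) (φ : 𝒜.LevelStructure g n)
    {m₀ : Z ⟶ W} {G : A₁.X.left ⟶ 𝒜.X.left} {Ĝ : D₁.hat.X.left ⟶ D.hat.X.left}
    (h : φ₁.IsBaseChangeVia φ m₀ G ∧ D₁.hat.IsBaseChangeVia D.hat m₀ Ĝ ∧
      (∃ (wG : A₁.X.hom ≫ m₀ = G ≫ 𝒜.X.hom) (wĜ : D₁.hat.X.hom ≫ m₀ = Ĝ ≫ D.hat.X.hom),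
        Nonempty ((Scheme.Modules.pullback (pullback.map A₁.X.hom D₁.hat.X.hom 𝒜.X.hom D.hat.X.hom G Ĝ m₀ wG wĜ)).obj D.P ≅ D₁.P)) ∧
      pol₁.lam.left ≫ Ĝ = G ≫ pol.lam.left ∧ ∀ a : O, (ρ₁.i a).left ≫ G = G ≫ (ρ.i a).left)
    {T' : Scheme.{0}} (t : T' ⟶ Z) :
    ∃ (H : (((𝒜.baseChange m₀).baseChange t)).X.left ⟶ (A₁.baseChange t).X.left)
      (Ĥ : ((D.baseChange m₀).baseChange t).hat.X.left ⟶ (D₁.baseChange t).hat.X.left),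
      ((φ.baseChange m₀).baseChange t).IsBaseChangeVia (φ₁.baseChange t) (𝟙 T') H ∧
      ((D.baseChange m₀).baseChange t).hat.IsBaseChangeVia (D₁.baseChange t).hat (𝟙 T') Ĥ ∧
      (∃ (wG : ((𝒜.baseChange m₀).baseChange t).X.hom ≫ 𝟙 T' = H ≫ (A₁.baseChange t).X.hom)
          (wĜ : ((D.baseChange m₀).baseChange t).hat.X.hom ≫ 𝟙 T' = Ĥ ≫ (D₁.baseChange t).hat.X.hom),
        Nonempty ((Scheme.Modules.pullback
          (pullback.map ((𝒜.baseChange m₀).baseChange t).X.hom ((D.baseChange m₀).baseChange t).hat.X.hom (A₁.baseChange t).X.hom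
            (D₁.baseChange t).hat.X.hom H Ĥ (𝟙 T') wG wĜ)).obj (D₁.baseChange t).P ≅ ((D.baseChange m₀).baseChange t).P)) ∧
      ((pol.baseChange m₀).baseChange t).lam.left ≫ Ĥ = H ≫ (pol₁.baseChange t).lam.left ∧
      ∀ a : O, (baseChangeHom (baseChangeHom (ρ.i a) m₀) t).left ≫ H = H ≫ (baseChangeHom (ρ₁.i a) t).left := by
  have h₁ := tupleRel_trans (tupleRel_baseChange_fst A₁ ρ₁ D₁ pol₁ φ₁ t) h
  have h₂ := tupleRel_trans (tupleRel_baseChange_fst (𝒜.baseChange m₀) (ρ.baseChange m₀) (D.baseChange m₀) (pol.baseChange m₀) (φ.baseChange m₀) t)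
    (tupleRel_baseChange_fst 𝒜 ρ D pol φ m₀)
  obtain ⟨H, Ĥ, -, -, -, -, hH⟩ := exists_tupleRel_id_of_tupleRel_of_tupleRel h₁ h₂
  exact ⟨H, Ĥ, hH⟩

/-- **GSPREAD-CORE, LOCALISED AND POINTWISE** — the `gen_iso` clauses of the spread.  In the situation of
`exists_stage_pelTuple_of_generic_of_iso_base_localise`, for every `T`, `τ`, `κ` AND EVERY `t : T′ → Z` (e.g. a geometric generic point of a sheet), the tuples
`((𝒜, ι, Â, 𝒫, λ, φ) ×_{P ⊗ D(s)} (P ⊗ Spec T)) ×_{(e ≫ P ◁ κ)} Z ×_Z T′` and `(A₁, ι₁, Â₁, 𝒫₁, λ₁, φ₁) ×_Z T′` are isomorphic as tuples (six clauses along `𝟙 T′`,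
★ `exists_tupleRel_id_baseChange_of_tupleRel`) — verbatim the clauses of the crux vocabulary `TupleIsoVia t (T-tuple ×  genIncl) (E-tuple)`.
[cite: MumfordFogartyKirwan1994, Ch. 7 §2 Definition 7.2 (p. 129)] [cite: EGAIV3, Thm. 8.8.2 and (8.8.2.5)] [cite: Kottwitz1992, §5 (pp. 389–391)] -/
theorem exists_stage_pelTuple_of_generic_of_iso_base_pointwise (hP : IsProper (pullback.snd P.hom (specOver A K).hom))
    (hdual : dualAbelianSchemeExists) {O : Type*} [CommRing O] {m : ℕ} (bs : Module.Basis (Fin m) ℤ O) {g N : ℕ} [NeZero N]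
    (hN : IsUnit ((N : ℕ) : K)) {Z : Scheme.{0}} (e : Z ≅ (P ⊗ specOver A K).left)
    (A₁ : AbelianSchemeOver Z) (ρ₁ : RingAction O A₁) (D₁ : A₁.DualPair) (pol₁ : A₁.Polarization D₁)
    (φ₁ : A₁.LevelStructure g N) (hg : A₁.IsOfRelDim g) :
    ∃ (s : Idx (nonZeroDivisors A)) (𝒜 : AbelianSchemeOver (P ⊗ (baseDiagram (nonZeroDivisors A)).obj s).left) (ρ : RingAction O 𝒜)
      (D : 𝒜.DualPair) (pol : 𝒜.Polarization D) (φ : 𝒜.LevelStructure g N),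
      𝒜.IsOfRelDim g ∧ Flat (pullback.snd P.hom ((baseDiagram (nonZeroDivisors A)).obj s).hom) ∧
      ∀ {T : Type} [CommRing T] [Algebra A T] (τ : specOver A T ⟶ (baseDiagram (nonZeroDivisors A)).obj s)
        (κ : specOver A K ⟶ specOver A T) {T' : Scheme.{0}} (t : T' ⟶ Z),
        ∃ (H : ((((𝒜.baseChange (P ◁ τ).left).baseChange (e.hom ≫ (P ◁ κ).left)).baseChange t)).X.left ⟶ (A₁.baseChange t).X.left)
          (Ĥ : (((D.baseChange (P ◁ τ).left).baseChange (e.hom ≫ (P ◁ κ).left)).baseChange t).hat.X.left ⟶ (D₁.baseChange t).hat.X.left),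
          (((φ.baseChange (P ◁ τ).left).baseChange (e.hom ≫ (P ◁ κ).left)).baseChange t).IsBaseChangeVia (φ₁.baseChange t) (𝟙 T') H ∧
          (((D.baseChange (P ◁ τ).left).baseChange (e.hom ≫ (P ◁ κ).left)).baseChange t).hat.IsBaseChangeVia (D₁.baseChange t).hat (𝟙 T') Ĥ ∧
          (∃ (wG : (((𝒜.baseChange (P ◁ τ).left).baseChange (e.hom ≫ (P ◁ κ).left)).baseChange t).X.hom ≫ 𝟙 T' =
                H ≫ (A₁.baseChange t).X.hom)
              (wĜ : (((D.baseChange (P ◁ τ).left).baseChange (e.hom ≫ (P ◁ κ).left)).baseChange t).hat.X.hom ≫ 𝟙 T' =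
                Ĥ ≫ (D₁.baseChange t).hat.X.hom),
            Nonempty ((Scheme.Modules.pullback
              (pullback.map (((𝒜.baseChange (P ◁ τ).left).baseChange (e.hom ≫ (P ◁ κ).left)).baseChange t).X.hom
                (((D.baseChange (P ◁ τ).left).baseChange (e.hom ≫ (P ◁ κ).left)).baseChange t).hat.X.hom (A₁.baseChange t).X.hom
                (D₁.baseChange t).hat.X.hom H Ĥ (𝟙 T') wG wĜ)).obj (D₁.baseChange t).P ≅
              (((D.baseChange (P ◁ τ).left).baseChange (e.hom ≫ (P ◁ κ).left)).baseChange t).P)) ∧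
          (((pol.baseChange (P ◁ τ).left).baseChange (e.hom ≫ (P ◁ κ).left)).baseChange t).lam.left ≫ Ĥ = H ≫ (pol₁.baseChange t).lam.left ∧
          ∀ a : O, (baseChangeHom (baseChangeHom ((ρ.baseChange (P ◁ τ).left).i a) (e.hom ≫ (P ◁ κ).left)) t).left ≫ H =
            H ≫ (baseChangeHom (ρ₁.i a) t).left := by
  obtain ⟨s, 𝒜, ρ, D, pol, φ, hg', hfl, hloc⟩ :=
    exists_stage_pelTuple_of_generic_of_iso_base_localise K hP hdual bs hN e A₁ ρ₁ D₁ pol₁ φ₁ hg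
  refine ⟨s, 𝒜, ρ, D, pol, φ, hg', hfl, fun {T} _ _ τ κ {T'} t => ?_⟩
  obtain ⟨G, Ĝ, h⟩ := hloc τ κ
  exact exists_tupleRel_id_baseChange_of_tupleRel ρ₁ D₁ pol₁ φ₁ (𝒜.baseChange (P ◁ τ).left) (ρ.baseChange (P ◁ τ).left)
    (D.baseChange (P ◁ τ).left) (pol.baseChange (P ◁ τ).left) (φ.baseChange (P ◁ τ).left) h t

end Head

end AbelianSchemeOver

end Literature.AlgebraicGeometry.AbelianSchemes
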